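import Mathlib
import Literature.Analysis.FluidPDE.SuitableWeak
import HarnessLib
/-!
# The MODULATION DICTIONARY of the Type-II (log-)modulated similarity ansatz, I: physical time and the τ-clock
# (zone Z1 TEMPLATE §T1.2 (N1), (N2), (N4), §T1.4 (C2) — kernel-checked)

HONEST FRAMING (cell ns-blowup GROUP B «PROFILE SEARCH», zone Z1 «Type-II log-modulated DSS ansatz for axisymmetric
Navier–Stokes — no CAP template exists, the template IS the deliverable»; human rulings D-0035/D-0074): this file
kernel-checks the ONE-VARIABLE CALCULUS of the template's change of variables (`HOME/profile/z1/TEMPLATE.md` §T1.0 (E1),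
§T1.2, profile-refuter K-audit PASS). **Nothing here is a statement about Navier–Stokes**: no solution, profile, blow-up or
regularity claim appears; the only fluid object mentioned is the tree's *definition* `Literature.Analysis.FluidPDE.IsTypeIBlowup`
(the Type-I rate `‖u(t)‖ ≤ C/√(T−t)` eventually), against which the gauge dictionary is stated literally, for an ARBITRARY
field `u` gauged by a scale `λ`. «violates: n/a — dictionary»; bears_on LADDER-NS N5/Z1 → N1 linear core / N0⁻.

THE CHANGE OF VARIABLES (TEMPLATE (E1)): blow-up time `T`, scale `λ(t) ↓ 0`, clock `τ(t) = ∫ λ⁻² dt`, MODULATION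
`a := −λ λ̇ = −½ d(λ²)/dt`; gauge N-a: `λ(t) := 1/‖u(t)‖_∞`. What is proved:
* (N2) `λ(t)² = 2 ∫_t^T a` when `λ(T) = 0` (`scale_sq_eq_two_mul_integral`); the FORWARD MEAN `ā(t) := (T−t)⁻¹∫_t^T a`
  equals `λ(t)²/(2(T−t))` (`forwardMean_eq`) and the Type-I quantity is `(T−t)·λ⁻² = 1/(2ā)` (`typeI_quantity_eq`).
* (N4)/(C2) pointwise: `λ⁻¹ ≤ C/√(T−t) ↔ 1/(2C²) ≤ ā` (`inv_scale_le_iff_forwardMean_ge`) and the Leray-side twin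
  `c/√(T−t) ≤ λ⁻¹ ↔ ā ≤ 1/(2c²)` (`leray_lower_iff_forwardMean_le`): Type I is a LOWER bound on `ā`, Leray's lower rate
  an UPPER bound.
* (N4)/(N4′) against the tree decl: for a field `u` with `‖u(t,x)‖ ≤ λ(t)⁻¹` near `T`, `ā ≥ c > 0` eventually ⇒
  `IsTypeIBlowup u T` (`isTypeIBlowup_of_forwardMean_ge`); conversely, if `λ⁻¹` is attained/exceeded at some point at each
  time (sup = max, TEMPLATE (G1)), `IsTypeIBlowup u T` ⇒ `ā` eventually bounded below (`forwardMean_ge_of_isTypeIBlowup`);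
  hence the template's `violates: V-T2` reads «liminf ā = 0» (`not_isTypeIBlowup_of_forwardMean_lt`).
* (N1) in the τ-clock: `λ(τ) = λ₀ exp(−∫_{τ₀}^τ a)` solves `dλ/dτ = −aλ` (`hasDerivAt_scale_exp`); the physical clock
  `t(τ) = t₀ + ∫_{τ₀}^τ λ²` has `dt/dτ = λ²` (`hasDerivAt_physicalClock`), converges to `T = t₀ + ∫_{τ₀}^∞ λ²` when `λ²`
  is integrable (`tendsto_physicalClock`: finite-time blow-up ⇔ `∫^∞ λ² < ∞`) with `T − t(τ) = ∫_τ^∞ λ²`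
  (`remaining_time_eq_integral_Ioi`).
The law classes of TEMPLATE (N3) (power-law `a = κ/τ`; log-modulated `λ² = (T−t)L^{−2κ′}`, Hou's `κ′ = ½`) are in the
companion file `TypeIIModulationLawClasses.lean`.

WHAT IS NOT HERE: anything about a fluid; TEMPLATE (L4)–(L6) (the inner object is a counterexample to an OPEN Liouville
problem — not computable); (G4)/(C9) is the tree's `Literature.Analysis.FluidPDE.not_jointFit_sqrtRate_logRate`; constant-
exponent dictionaries are `Literature.Analysis.FluidPDE.SelfSimilarCollapseAnsatz` / `…HouTwoScaleRescaling`. PLACEMENT: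
cell-own calculus next to `AxisModelExponentDictionary` (profile-eng-10). Author: ns-blowup-profile-eng-1 g4, 2026-08-26.
-/
open Real Filter Topology MeasureTheory Set intervalIntegral

namespace Summit.NavierStokesRegularity.OSWSelfSimilar
namespace TypeIIModulationDictionary

/-! ## §1 Physical time: `λ² = 2∫a`, the forward mean, and the Type-I dictionary (TEMPLATE (N2), (N4), (C2)) -/

/-- **(N2)** If the scale `λ` has derivative `λ′` on `[t, T]`, `λλ′` is integrable there and `λ(T) = 0`, then
`λ(t)² = 2 ∫_t^T a` with the MODULATION `a := −λ λ′ = −½ (λ²)′`. (Fundamental theorem of calculus.) [new here — dictionary] -/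
theorem scale_sq_eq_two_mul_integral {lam dlam : ℝ → ℝ} {t T : ℝ}
    (hderiv : ∀ s ∈ uIcc t T, HasDerivAt lam (dlam s) s)
    (hint : IntervalIntegrable (fun s => lam s * dlam s) volume t T) (hT : lam T = 0) :
    lam t ^ 2 = 2 * ∫ s in t..T, -(lam s * dlam s) := by
  have hF : ∀ s ∈ uIcc t T, HasDerivAt (fun s => lam s * lam s) (dlam s * lam s + lam s * dlam s) s :=
    fun s hs => (hderiv s hs).mul (hderiv s hs)
  have hint2 : IntervalIntegrable (fun s => dlam s * lam s + lam s * dlam s) volume t T := by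
    have : (fun s => dlam s * lam s + lam s * dlam s) = fun s => 2 * (lam s * dlam s) := by
      funext s; ring
    rw [this]; exact hint.const_mul 2
  have hftc := integral_eq_sub_of_hasDerivAt hF hint2
  have h2 : (∫ s in t..T, dlam s * lam s + lam s * dlam s) = 2 * ∫ s in t..T, lam s * dlam s := by
    have : (fun s => dlam s * lam s + lam s * dlam s) = fun s => 2 * (lam s * dlam s) := by
      funext s; ring
    rw [this, intervalIntegral.integral_const_mul]
  rw [hT, h2] at hftc
  rw [intervalIntegral.integral_neg]
  nlinarith [hftc]

/-- **The forward mean.** With `λ(t)² = 2∫_t^T a` (previous lemma, `a = −λλ′`), the forward time-average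
`ā(t) := (T−t)⁻¹ ∫_t^T a` equals `λ(t)²/(2(T−t))` — the quantity every later statement is phrased in. [new here — dictionary] -/
theorem forwardMean_eq {lam dlam : ℝ → ℝ} {t T : ℝ}
    (hderiv : ∀ s ∈ uIcc t T, HasDerivAt lam (dlam s) s)
    (hint : IntervalIntegrable (fun s => lam s * dlam s) volume t T) (hT : lam T = 0) :
    (T - t)⁻¹ * ∫ s in t..T, -(lam s * dlam s) = lam t ^ 2 / (2 * (T - t)) := by
  rw [scale_sq_eq_two_mul_integral hderiv hint hT]
  rcases eq_or_ne (T - t) 0 with h | h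
  · simp [h]
  · field_simp

/-- **(N4) dictionary, pointwise.** In gauge N-a (`‖u(t)‖_∞ = λ(t)⁻¹`) the Type-I quantity is
`(T − t)·λ(t)⁻² = 1/(2ā(t))` with `ā(t) = λ(t)²/(2(T−t))`. [new here — dictionary] -/
theorem typeI_quantity_eq {lamt t T : ℝ} (ht : t < T) (hlam : 0 < lamt) :
    (T - t) * lamt⁻¹ ^ 2 = (2 * (lamt ^ 2 / (2 * (T - t))))⁻¹ := by
  have h1 : 0 < T - t := sub_pos.mpr ht
  field_simp

/-- **(N4) Type-I side.** For `t < T`, `λ > 0`, `C > 0`: `λ⁻¹ ≤ C/√(T−t) ↔ 1/(2C²) ≤ λ²/(2(T−t)) = ā`.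
[new here — dictionary] -/
theorem inv_scale_le_iff_forwardMean_ge {lamt t T C : ℝ} (ht : t < T) (hlam : 0 < lamt) (hC : 0 < C) :
    lamt⁻¹ ≤ C / Real.sqrt (T - t) ↔ 1 / (2 * C ^ 2) ≤ lamt ^ 2 / (2 * (T - t)) := by
  have h1 : 0 < T - t := sub_pos.mpr ht
  have hs : 0 < Real.sqrt (T - t) := Real.sqrt_pos.mpr h1
  have hsq : Real.sqrt (T - t) ^ 2 = T - t := Real.sq_sqrt h1.le
  rw [inv_le_comm₀ hlam (div_pos hC hs), inv_div, div_le_iff₀ hC,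
    div_le_div_iff₀ (by positivity) (by positivity)]
  constructor
  · intro h
    have h' : Real.sqrt (T - t) ^ 2 ≤ (lamt * C) ^ 2 := by
      exact pow_le_pow_left₀ hs.le h 2
    nlinarith [h', hsq]
  · intro h
    have h' : Real.sqrt (T - t) ^ 2 ≤ (lamt * C) ^ 2 := by nlinarith [h, hsq]
    exact (pow_le_pow_iff_left₀ hs.le (by positivity) two_ne_zero).mp h'

/-- **(C2) Leray side.** For `t < T`, `λ > 0`, `c > 0`: the Leray lower rate `c/√(T−t) ≤ λ⁻¹` holds iff
`ā = λ²/(2(T−t)) ≤ 1/(2c²)` — Leray's lower bound is an UPPER bound on the forward mean of `a`. [new here — dictionary] -/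
theorem leray_lower_iff_forwardMean_le {lamt t T c : ℝ} (ht : t < T) (hlam : 0 < lamt) (hc : 0 < c) :
    c / Real.sqrt (T - t) ≤ lamt⁻¹ ↔ lamt ^ 2 / (2 * (T - t)) ≤ 1 / (2 * c ^ 2) := by
  have h1 : 0 < T - t := sub_pos.mpr ht
  have hs : 0 < Real.sqrt (T - t) := Real.sqrt_pos.mpr h1
  have hsq : Real.sqrt (T - t) ^ 2 = T - t := Real.sq_sqrt h1.le
  rw [le_inv_comm₀ (div_pos hc hs) hlam, inv_div, le_div_iff₀ hc,
    div_le_div_iff₀ (by positivity) (by positivity)]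
  constructor
  · intro h
    have h' : (lamt * c) ^ 2 ≤ Real.sqrt (T - t) ^ 2 := pow_le_pow_left₀ (by positivity) h 2
    nlinarith [h', hsq]
  · intro h
    have h' : (lamt * c) ^ 2 ≤ Real.sqrt (T - t) ^ 2 := by nlinarith [h, hsq]
    exact (pow_le_pow_iff_left₀ (by positivity) hs.le two_ne_zero).mp h'

section gauge

variable {E : Type*} [NormedAddCommGroup E]

/-- **(N4) ⇐, literally against the tree's `IsTypeIBlowup`.** If a field `u` is gauged by `λ` from above near `T`
(`‖u(t,x)‖ ≤ λ(t)⁻¹`, `λ > 0`) and the forward mean `ā(t) = λ(t)²/(2(T−t))` is eventually `≥ c > 0`, then `u` obeys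
the Type-I rate with `C = 1/√(2c)`. [new here — dictionary] -/
theorem isTypeIBlowup_of_forwardMean_ge {u : ℝ → E → E} {T : ℝ} {lam : ℝ → ℝ} {c : ℝ} (hc : 0 < c)
    (hlam : ∀ᶠ t in 𝓝[<] T, 0 < lam t) (hbound : ∀ᶠ t in 𝓝[<] T, ∀ x, ‖u t x‖ ≤ (lam t)⁻¹)
    (hmean : ∀ᶠ t in 𝓝[<] T, c ≤ lam t ^ 2 / (2 * (T - t))) :
    Literature.Analysis.FluidPDE.IsTypeIBlowup u T := by
  refine ⟨1 / Real.sqrt (2 * c), ?_⟩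
  have hlt : ∀ᶠ t in 𝓝[<] T, t < T := eventually_nhdsWithin_of_forall fun t ht => ht
  filter_upwards [hlam, hbound, hmean, hlt] with t h1 h2 h3 h4
  intro x
  have hC : 0 < 1 / Real.sqrt (2 * c) := by positivity
  have key : (lam t)⁻¹ ≤ (1 / Real.sqrt (2 * c)) / Real.sqrt (T - t) := by
    rw [inv_scale_le_iff_forwardMean_ge h4 h1 hC]
    have : 1 / (2 * (1 / Real.sqrt (2 * c)) ^ 2) = c := by
      rw [div_pow, one_pow, Real.sq_sqrt (by positivity)]; field_simp
    rw [this]; exact h3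
  exact (h2 x).trans key

/-- **(N4) ⇒.** If `u` is Type I at `T` and `λ(t)⁻¹` is (eventually) ATTAINED OR EXCEEDED by `‖u(t, ·)‖` at some point
(gauge N-a: `λ = 1/‖u‖_∞` with the supremum a maximum — TEMPLATE (G1)), then the forward mean is eventually bounded
below: `∃ c > 0, ā(t) ≥ c` near `T`. [new here — dictionary] -/
theorem forwardMean_ge_of_isTypeIBlowup {u : ℝ → E → E} {T : ℝ} {lam : ℝ → ℝ}
    (hlam : ∀ᶠ t in 𝓝[<] T, 0 < lam t) (hattain : ∀ᶠ t in 𝓝[<] T, ∃ x, (lam t)⁻¹ ≤ ‖u t x‖)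
    (hI : Literature.Analysis.FluidPDE.IsTypeIBlowup u T) :
    ∃ c : ℝ, 0 < c ∧ ∀ᶠ t in 𝓝[<] T, c ≤ lam t ^ 2 / (2 * (T - t)) := by
  obtain ⟨C, hCev⟩ := hI
  have hlt : ∀ᶠ t in 𝓝[<] T, t < T := eventually_nhdsWithin_of_forall fun t ht => ht
  -- `C > 0` is forced: at one time the attained positive value sits below `C/√(T−t)`.
  have hCpos : 0 < C := by
    obtain ⟨t, h1, ⟨x, hx⟩, h3, h4⟩ := (hlam.and (hattain.and (hCev.and hlt))).exists
    have hpos : 0 < C / Real.sqrt (T - t) := lt_of_lt_of_le (lt_of_lt_of_le (inv_pos.mpr h1) hx) (h3 x)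
    have hs : 0 < Real.sqrt (T - t) := Real.sqrt_pos.mpr (sub_pos.mpr h4)
    by_contra hC
    have : C / Real.sqrt (T - t) ≤ 0 := div_nonpos_of_nonpos_of_nonneg (not_lt.mp hC) hs.le
    linarith
  refine ⟨1 / (2 * C ^ 2), by positivity, ?_⟩
  filter_upwards [hlam, hattain, hCev, hlt] with t h1 ⟨x, hx⟩ h3 h4
  exact (inv_scale_le_iff_forwardMean_ge h4 h1 hCpos).mp (hx.trans (h3 x))

/-- **`violates: V-T2` in template variables (TEMPLATE (N4′)/(N5)).** In gauge N-a (sup attained), if for every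
`c > 0` the forward mean `ā(t) = λ(t)²/(2(T−t))` drops below `c` at times arbitrarily close to `T` («liminf ā = 0»), the
field is NOT Type I. Contrapositive of `forwardMean_ge_of_isTypeIBlowup`. [new here — dictionary] -/
theorem not_isTypeIBlowup_of_forwardMean_lt {u : ℝ → E → E} {T : ℝ} {lam : ℝ → ℝ}
    (hlam : ∀ᶠ t in 𝓝[<] T, 0 < lam t) (hattain : ∀ᶠ t in 𝓝[<] T, ∃ x, (lam t)⁻¹ ≤ ‖u t x‖)
    (hliminf : ∀ c : ℝ, 0 < c → ∃ᶠ t in 𝓝[<] T, lam t ^ 2 / (2 * (T - t)) < c) :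
    ¬ Literature.Analysis.FluidPDE.IsTypeIBlowup u T := by
  intro hI
  obtain ⟨c, hc, hev⟩ := forwardMean_ge_of_isTypeIBlowup hlam hattain hI
  exact (hliminf c hc).and_eventually hev |>.exists.elim fun t ht => (not_le.mpr ht.1) ht.2

end gauge

/-! ## §2 The τ-clock: `λ(τ) = λ₀ e^{−∫a}` and `t(τ) = t₀ + ∫ λ²` (TEMPLATE (N1)) -/

/-- **(N1)** For a continuous modulation `a`, `λ(τ) := λ₀ exp(−∫_{τ₀}^τ a)` solves the scale ODE `dλ/dτ = −a(τ) λ(τ)`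
(the τ-clock form of `a = −λ dλ/dt`, `dt = λ² dτ`). [new here — dictionary] -/
theorem hasDerivAt_scale_exp {a : ℝ → ℝ} (ha : Continuous a) (lam0 τ0 τ : ℝ) :
    HasDerivAt (fun σ => lam0 * Real.exp (-(∫ s in τ0..σ, a s)))
      (-(a τ) * (lam0 * Real.exp (-(∫ s in τ0..τ, a s)))) τ := by
  have h1 : HasDerivAt (fun σ => ∫ s in τ0..σ, a s) (a τ) τ := (ha.integral_hasStrictDerivAt τ0 τ).hasDerivAt
  have h1' : HasDerivAt (fun σ => -(∫ s in τ0..σ, a s)) (-(a τ)) τ := h1.neg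
  have h2 := (h1'.exp).const_mul lam0
  refine h2.congr_deriv ?_
  ring

/-- **(N1) clock.** For a continuous scale `λ`, the physical clock `t(τ) := t₀ + ∫_{τ₀}^τ λ(σ)² dσ` has
`dt/dτ = λ(τ)²` (i.e. `dτ/dt = λ⁻²`). [new here — dictionary] -/
theorem hasDerivAt_physicalClock {lam : ℝ → ℝ} (hlam : Continuous lam) (t0 τ0 τ : ℝ) :
    HasDerivAt (fun σ => t0 + ∫ s in τ0..σ, lam s ^ 2) (lam τ ^ 2) τ := by
  have h1 : HasDerivAt (fun σ => ∫ s in τ0..σ, lam s ^ 2) (lam τ ^ 2) τ :=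
    ((hlam.pow 2).integral_hasStrictDerivAt τ0 τ).hasDerivAt
  simpa using h1.const_add t0

/-- **(N1) finite-time blow-up ⇔ `∫^∞ λ² < ∞`.** If `λ²` is integrable on `(τ₀, ∞)`, the physical clock converges:
`t(τ) → T := t₀ + ∫_{τ₀}^∞ λ²` as `τ → ∞` — the singular time is reached at τ = ∞. [new here — dictionary] -/
theorem tendsto_physicalClock {lam : ℝ → ℝ} (t0 τ0 : ℝ)
    (hint : IntegrableOn (fun s => lam s ^ 2) (Ioi τ0)) :
    Tendsto (fun σ => t0 + ∫ s in τ0..σ, lam s ^ 2) atTop (𝓝 (t0 + ∫ s in Ioi τ0, lam s ^ 2)) :=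
  (intervalIntegral_tendsto_integral_Ioi τ0 hint tendsto_id).const_add t0

/-- The remaining time in the clock: for `τ₀ ≤ τ`, `T − t(τ) = ∫_τ^∞ λ²` with `T = t₀ + ∫_{τ₀}^∞ λ²`,
`t(τ) = t₀ + ∫_{τ₀}^τ λ²`. [new here — dictionary] -/
theorem remaining_time_eq_integral_Ioi {lam : ℝ → ℝ} (t0 : ℝ) {τ0 τ : ℝ} (hτ : τ0 ≤ τ)
    (hint : IntegrableOn (fun s => lam s ^ 2) (Ioi τ0)) :
    (t0 + ∫ s in Ioi τ0, lam s ^ 2) - (t0 + ∫ s in τ0..τ, lam s ^ 2) = ∫ s in Ioi τ, lam s ^ 2 := by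
  have hsplit : ∫ s in Ioi τ0, lam s ^ 2 = (∫ s in Ioc τ0 τ, lam s ^ 2) + ∫ s in Ioi τ, lam s ^ 2 := by
    rw [← setIntegral_union (Set.Ioc_disjoint_Ioi le_rfl) measurableSet_Ioi
      (hint.mono_set Ioc_subset_Ioi_self) (hint.mono_set (Ioi_subset_Ioi hτ)),
      Ioc_union_Ioi_eq_Ioi hτ]
  rw [intervalIntegral.integral_of_le hτ, hsplit]
  ring

end TypeIIModulationDictionary
end Summit.NavierStokesRegularity.OSWSelfSimilar
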